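import Summits.ValiantsHypothesis.ValiantsHypothesis.Theorems.LacunarySymmetroidMatrixDescartesPivotRankOneCriticalWindowsFourFoldEnd

/-!
# `MatrixDescartes` census — rank-one `(2,4)₁`, lone letter: the WINDOW WRONSKIAN IS NEGATIVE, the Cramer coefficient `a₁ = M_{ji}/M_{0j}` DECREASES
# along the right window, and along branch `0` the scale INCREASES with the direction

HONEST FRAMING.  Object-search cell `pub-symmetroid`, seat `val-sym-mdr-p1` (generation 22); helper file `--supports` the crux item
stmt-ValiantsHypothesis-18050 (`Theses.LacunarySymmetroid.MatrixDescartes`, OPEN, on HOLD) with NO closure claim.  Third kernel piece of the `K = 4`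
lone-letter programme (seat memo LONE-LETTER.md §8b–§8e); companions `…CriticalWindowsFourCramer` (frame, minor signs), `…FourFoldEnd` (end coefficients
of the fold quadratic = `K = 3` logarithmic derivatives).  No count is proved; nothing bears on `MatrixDescartes` in its window, on `DoorA26` / `DoorA34`,
registers / credences, or `VP ≠ VNP`.

THE POINT (def-free; `Q₀ = bⱼ(T+tᵢ)(T−tⱼ) − bᵢ(T+tⱼ)(T−tᵢ)`, `Qᵢ = bⱼ(T+t₀)(tⱼ−T) − a(T+tⱼ)(T−t₀)` the brackets of the triple `{0, i, j}`).
* **§1 `wronskian_neg` — `Q₀′(T)·Qᵢ(T) − Q₀(T)·Qᵢ′(T) < 0` for EVERY real `T`** (`0 < tᵢ < t₀ < tⱼ`, positive rates): the Wronskian is a quadratic in `T`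
  with negative leading coefficient whose discriminant is minus a polynomial with 57 POSITIVE coefficients in `(a, bᵢ, bⱼ, tᵢ, t₀−tᵢ, tⱼ−t₀)`. [folklore]
* §2 `coeffA1_deriv_neg`, `coeffA1_strictAntiOn` — on the right window `(Tₘ, tⱼ)` the Cramer coefficient `a₁ = M_{ji}/M_{0j}` (memo §8b: `W₀/Wᵢ = a₁ + b₁ρ`)
  has `a₁′ = a₁·[(Q₀′Qᵢ − Q₀Qᵢ′)/(Q₀Qᵢ) + 1/(T−tᵢ) − 1/(T−t₀)] < 0`, so it is STRICTLY DECREASING (the same statement with `(bₖ,tₖ)` for `(bᵢ,tᵢ)` is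
  `b₁ = M_{jk}/M_{0j}` decreasing). [folklore]
* **§3 `branch0_scale_strictMono` — along branch `0` the scale increases with the direction:** if `(x₁,T₁)`, `(x₂,T₂)` both satisfy the first Cramer
  identity `w₀x^{d₀}|M_{0j}(T)| = wᵢx^{dᵢ}|M_{ji}(T)| + wₖx^{dₖ}|M_{jk}(T)|` (in particular if they are critical points of the four-letter window profile) with
  `Tₘ < T₁ < T₂ < tⱼ`, `d₀ < dᵢ, dₖ`, then `x₁ < x₂`.  With `…FourCramer.critical_scale_unique` the critical set on the lone letter's side is therefore the
  graph of a strictly increasing function of the direction wherever it is defined (memo §8e: the `h₁`-level curves are increasing graphs; this is one half of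
  the located statement (F2), the other half being that the fold set is a decreasing graph).
[folklore] Discriminants, the quotient rule, strict monotonicity from the sign of the derivative.  No definitions, no named facts.
-/

-- `Summit.ValiantsHypothesis.ValiantsHypothesis.…` repeats a component by the D-0017 layout
-- (single-conjunct summit), which the `dupNamespace` linter flags; the name is mandated.
set_option linter.dupNamespace false

namespace Summit.ValiantsHypothesis.ValiantsHypothesis.Theorems.LacunarySymmetroidMatrixDescartes.Pivot.CriticalWindows.Four

open Summit.ValiantsHypothesis.ValiantsHypothesis.Theorems.LacunarySymmetroidMatrixDescartes.Pivot.CriticalWindows.Three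

/-! ## 1. The window Wronskian is negative everywhere -/

/-- **THE DISCRIMINANT POLYNOMIAL IS POSITIVE.**  In the positive variables `a, bᵢ, bⱼ, tᵢ, v = t₀ − tᵢ, u = tⱼ − t₀` the quantity `4c₂c₀ − c₁²` of the
Wronskian `c₂T² + c₁T + c₀` is a polynomial with positive coefficients. [folklore: computation] -/
theorem wronskian_disc_pos {a bi bj ti v u : ℝ} (ha : 0 < a) (hbi : 0 < bi) (hbj : 0 < bj) (hti : 0 < ti) (hv : 0 < v) (hu : 0 < u) :
    0 < (16 * a ^ (2:ℕ) * bi * bj * ti ^ (2:ℕ) * v ^ (2:ℕ) + 16 * a ^ (2:ℕ) * bi * bj * ti ^ (2:ℕ) * v * u + 32 * a ^ (2:ℕ) *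
      bi * bj * ti * v ^ (3:ℕ) + 56 * a ^ (2:ℕ) * bi * bj * ti * v ^ (2:ℕ) * u + 24 * a ^ (2:ℕ) * bi * bj * ti * v * u ^
      (2:ℕ) + 16 * a ^ (2:ℕ) * bi * bj * v ^ (4:ℕ) + 40 * a ^ (2:ℕ) * bi * bj * v ^ (3:ℕ) * u + 32 * a ^ (2:ℕ) * bi * bj * v
      ^ (2:ℕ) * u ^ (2:ℕ) + 8 * a ^ (2:ℕ) * bi * bj * v * u ^ (3:ℕ) + 16 * a ^ (2:ℕ) * bj ^ (2:ℕ) * ti ^ (2:ℕ) * v * u + 16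
      * a ^ (2:ℕ) * bj ^ (2:ℕ) * ti ^ (2:ℕ) * u ^ (2:ℕ) + 24 * a ^ (2:ℕ) * bj ^ (2:ℕ) * ti * v ^ (2:ℕ) * u + 40 * a ^ (2:ℕ)
      * bj ^ (2:ℕ) * ti * v * u ^ (2:ℕ) + 16 * a ^ (2:ℕ) * bj ^ (2:ℕ) * ti * u ^ (3:ℕ) + 8 * a ^ (2:ℕ) * bj ^ (2:ℕ) * v ^
      (3:ℕ) * u + 16 * a ^ (2:ℕ) * bj ^ (2:ℕ) * v ^ (2:ℕ) * u ^ (2:ℕ) + 8 * a ^ (2:ℕ) * bj ^ (2:ℕ) * v * u ^ (3:ℕ) + 16 * a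
      * bi ^ (2:ℕ) * bj * ti ^ (2:ℕ) * v * u + 24 * a * bi ^ (2:ℕ) * bj * ti * v ^ (2:ℕ) * u + 24 * a * bi ^ (2:ℕ) * bj * ti
      * v * u ^ (2:ℕ) + 8 * a * bi ^ (2:ℕ) * bj * v ^ (3:ℕ) * u + 16 * a * bi ^ (2:ℕ) * bj * v ^ (2:ℕ) * u ^ (2:ℕ) + 8 * a *
      bi ^ (2:ℕ) * bj * v * u ^ (3:ℕ) + 32 * a * bi * bj ^ (2:ℕ) * ti ^ (2:ℕ) * v ^ (2:ℕ) + 32 * a * bi * bj ^ (2:ℕ) * ti ^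
      (2:ℕ) * v * u + 32 * a * bi * bj ^ (2:ℕ) * ti ^ (2:ℕ) * u ^ (2:ℕ) + 64 * a * bi * bj ^ (2:ℕ) * ti * v ^ (3:ℕ) + 112 *
      a * bi * bj ^ (2:ℕ) * ti * v ^ (2:ℕ) * u + 80 * a * bi * bj ^ (2:ℕ) * ti * v * u ^ (2:ℕ) + 32 * a * bi * bj ^ (2:ℕ) *
      ti * u ^ (3:ℕ) + 32 * a * bi * bj ^ (2:ℕ) * v ^ (4:ℕ) + 80 * a * bi * bj ^ (2:ℕ) * v ^ (3:ℕ) * u + 64 * a * bi * bj ^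
      (2:ℕ) * v ^ (2:ℕ) * u ^ (2:ℕ) + 16 * a * bi * bj ^ (2:ℕ) * v * u ^ (3:ℕ) + 16 * a * bj ^ (3:ℕ) * ti ^ (2:ℕ) * v * u +
      24 * a * bj ^ (3:ℕ) * ti * v ^ (2:ℕ) * u + 24 * a * bj ^ (3:ℕ) * ti * v * u ^ (2:ℕ) + 8 * a * bj ^ (3:ℕ) * v ^ (3:ℕ) *
      u + 16 * a * bj ^ (3:ℕ) * v ^ (2:ℕ) * u ^ (2:ℕ) + 8 * a * bj ^ (3:ℕ) * v * u ^ (3:ℕ) + 16 * bi ^ (2:ℕ) * bj ^ (2:ℕ) *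
      ti ^ (2:ℕ) * v * u + 16 * bi ^ (2:ℕ) * bj ^ (2:ℕ) * ti ^ (2:ℕ) * u ^ (2:ℕ) + 24 * bi ^ (2:ℕ) * bj ^ (2:ℕ) * ti * v ^
      (2:ℕ) * u + 40 * bi ^ (2:ℕ) * bj ^ (2:ℕ) * ti * v * u ^ (2:ℕ) + 16 * bi ^ (2:ℕ) * bj ^ (2:ℕ) * ti * u ^ (3:ℕ) + 8 * bi
      ^ (2:ℕ) * bj ^ (2:ℕ) * v ^ (3:ℕ) * u + 16 * bi ^ (2:ℕ) * bj ^ (2:ℕ) * v ^ (2:ℕ) * u ^ (2:ℕ) + 8 * bi ^ (2:ℕ) * bj ^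
      (2:ℕ) * v * u ^ (3:ℕ) + 16 * bi * bj ^ (3:ℕ) * ti ^ (2:ℕ) * v ^ (2:ℕ) + 16 * bi * bj ^ (3:ℕ) * ti ^ (2:ℕ) * v * u + 32
      * bi * bj ^ (3:ℕ) * ti * v ^ (3:ℕ) + 56 * bi * bj ^ (3:ℕ) * ti * v ^ (2:ℕ) * u + 24 * bi * bj ^ (3:ℕ) * ti * v * u ^
      (2:ℕ) + 16 * bi * bj ^ (3:ℕ) * v ^ (4:ℕ) + 40 * bi * bj ^ (3:ℕ) * v ^ (3:ℕ) * u + 32 * bi * bj ^ (3:ℕ) * v ^ (2:ℕ) * u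
      ^ (2:ℕ) + 8 * bi * bj ^ (3:ℕ) * v * u ^ (3:ℕ)) := by
  positivity

/-- **THE WINDOW WRONSKIAN IS NEGATIVE.**  For `0 < tᵢ < t₀ < tⱼ` and positive rates, `Q₀′(T)Qᵢ(T) − Q₀(T)Qᵢ′(T) < 0` for every real `T` (negative leading
coefficient, negative discriminant). [folklore] -/
theorem wronskian_neg {a bi bj t₀ ti tj : ℝ} (ha : 0 < a) (hbi : 0 < bi) (hbj : 0 < bj) (hti : 0 < ti) (hi0 : ti < t₀) (h0j : t₀ < tj)
    (T : ℝ) :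
    (bj * ((T - tj) + (T + ti)) - bi * ((T - ti) + (T + tj))) * (bj * (T + t₀) * (tj - T) - a * (T + tj) * (T - t₀)) - (bj * (T + ti) * (T - tj) - bi * (T + tj) * (T - ti)) * (bj * ((tj - T) - (T + t₀)) - a * ((T - t₀) + (T + tj))) < 0 := by
  have hv : 0 < t₀ - ti := by linarith
  have hu : 0 < tj - t₀ := by linarith
  have hE := wronskian_disc_pos ha hbi hbj hti hv hu
  -- the Wronskian as an explicit quadratic `c₂T² + c₁T + c₀`
  have hc2 : -a * bi * t₀ + a * bi * ti + a * bj * t₀ + a * bj * ti - 2 * a * bj * tj + bi * bj * t₀ + bi * bj * ti - 2 * bi * bj * tj - bj ^ (2:ℕ) * t₀ + bj ^ (2:ℕ) * ti < 0 := by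
    have e : -a * bi * t₀ + a * bi * ti + a * bj * t₀ + a * bj * ti - 2 * a * bj * tj + bi * bj * t₀ + bi * bj * ti - 2 * bi * bj * tj - bj ^ (2:ℕ) * t₀ + bj ^ (2:ℕ) * ti
        = -((t₀ - ti) * (a * bi + bj ^ (2:ℕ)) + (2 * tj - t₀ - ti) * bj * (a + bi)) := by ring
    rw [e]
    have : 0 < (t₀ - ti) * (a * bi + bj ^ (2:ℕ)) := by positivity
    have : 0 < (2 * tj - t₀ - ti) * bj * (a + bi) := mul_pos (mul_pos (by linarith) hbj) (by linarith)
    linarith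
  have key : 4 * (-a * bi * t₀ + a * bi * ti + a * bj * t₀ + a * bj * ti - 2 * a * bj * tj + bi * bj * t₀ + bi * bj * ti - 2 * bi * bj * tj - bj ^ (2:ℕ) * t₀ + bj ^ (2:ℕ) * ti) * ((bj * ((T - tj) + (T + ti)) - bi * ((T - ti) + (T + tj))) * (bj * (T + t₀) * (tj - T) - a * (T + tj) * (T - t₀)) - (bj * (T + ti) * (T - tj) - bi * (T + tj) * (T - ti)) * (bj * ((tj - T) - (T + t₀)) - a * ((T - t₀) + (T + tj))))
      = (2 * (-a * bi * t₀ + a * bi * ti + a * bj * t₀ + a * bj * ti - 2 * a * bj * tj + bi * bj * t₀ + bi * bj * ti - 2 * bi * bj * tj - bj ^ (2:ℕ) * t₀ + bj ^ (2:ℕ) * ti) * T + (-2 * a * bi * t₀ * tj + 2 * a * bi * ti * tj + 2 * a * bj * t₀ * tj - 2 * a * bj * ti * tj - 2 * bi * bj * t₀ * tj + 2 * bi * bj * ti * tj + 2 * bj ^ (2:ℕ) * t₀ * tj - 2 * bj ^ (2:ℕ) * ti * tj)) ^ (2:ℕ) + (16 * a ^ (2:ℕ) * bi * bj * ti ^ (2:ℕ)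 * (t₀ - ti) ^ (2:ℕ) + 16 * a ^ (2:ℕ) * bi * bj * ti ^ (2:ℕ) * (t₀ - ti) * (tj -
        t₀) + 32 * a ^ (2:ℕ) * bi * bj * ti * (t₀ - ti) ^ (3:ℕ) + 56 * a ^ (2:ℕ) * bi * bj * ti * (t₀ - ti) ^ (2:ℕ) * (tj -
        t₀) + 24 * a ^ (2:ℕ) * bi * bj * ti * (t₀ - ti) * (tj - t₀) ^ (2:ℕ) + 16 * a ^ (2:ℕ) * bi * bj * (t₀ - ti) ^ (4:ℕ) +
        40 * a ^ (2:ℕ) * bi * bj * (t₀ - ti) ^ (3:ℕ) * (tj - t₀) + 32 * a ^ (2:ℕ) * bi * bj * (t₀ - ti) ^ (2:ℕ) * (tj - t₀) ^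
        (2:ℕ) + 8 * a ^ (2:ℕ) * bi * bj * (t₀ - ti) * (tj - t₀) ^ (3:ℕ) + 16 * a ^ (2:ℕ) * bj ^ (2:ℕ) * ti ^ (2:ℕ) * (t₀ - ti)
        * (tj - t₀) + 16 * a ^ (2:ℕ) * bj ^ (2:ℕ) * ti ^ (2:ℕ) * (tj - t₀) ^ (2:ℕ) + 24 * a ^ (2:ℕ) * bj ^ (2:ℕ) * ti * (t₀ -
        ti) ^ (2:ℕ) * (tj - t₀) + 40 * a ^ (2:ℕ) * bj ^ (2:ℕ) * ti * (t₀ - ti) * (tj - t₀) ^ (2:ℕ) + 16 * a ^ (2:ℕ) * bj ^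
        (2:ℕ) * ti * (tj - t₀) ^ (3:ℕ) + 8 * a ^ (2:ℕ) * bj ^ (2:ℕ) * (t₀ - ti) ^ (3:ℕ) * (tj - t₀) + 16 * a ^ (2:ℕ) * bj ^
        (2:ℕ) * (t₀ - ti) ^ (2:ℕ) * (tj - t₀) ^ (2:ℕ) + 8 * a ^ (2:ℕ) * bj ^ (2:ℕ) * (t₀ - ti) * (tj - t₀) ^ (3:ℕ) + 16 * a *
        bi ^ (2:ℕ) * bj * ti ^ (2:ℕ) * (t₀ - ti) * (tj - t₀) + 24 * a * bi ^ (2:ℕ) * bj * ti * (t₀ - ti) ^ (2:ℕ) * (tj - t₀) +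
        24 * a * bi ^ (2:ℕ) * bj * ti * (t₀ - ti) * (tj - t₀) ^ (2:ℕ) + 8 * a * bi ^ (2:ℕ) * bj * (t₀ - ti) ^ (3:ℕ) * (tj -
        t₀) + 16 * a * bi ^ (2:ℕ) * bj * (t₀ - ti) ^ (2:ℕ) * (tj - t₀) ^ (2:ℕ) + 8 * a * bi ^ (2:ℕ) * bj * (t₀ - ti) * (tj -
        t₀) ^ (3:ℕ) + 32 * a * bi * bj ^ (2:ℕ) * ti ^ (2:ℕ) * (t₀ - ti) ^ (2:ℕ) + 32 * a * bi * bj ^ (2:ℕ) * ti ^ (2:ℕ) * (t₀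
        - ti) * (tj - t₀) + 32 * a * bi * bj ^ (2:ℕ) * ti ^ (2:ℕ) * (tj - t₀) ^ (2:ℕ) + 64 * a * bi * bj ^ (2:ℕ) * ti * (t₀ -
        ti) ^ (3:ℕ) + 112 * a * bi * bj ^ (2:ℕ) * ti * (t₀ - ti) ^ (2:ℕ) * (tj - t₀) + 80 * a * bi * bj ^ (2:ℕ) * ti * (t₀ -
        ti) * (tj - t₀) ^ (2:ℕ) + 32 * a * bi * bj ^ (2:ℕ) * ti * (tj - t₀) ^ (3:ℕ) + 32 * a * bi * bj ^ (2:ℕ) * (t₀ - ti) ^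
        (4:ℕ) + 80 * a * bi * bj ^ (2:ℕ) * (t₀ - ti) ^ (3:ℕ) * (tj - t₀) + 64 * a * bi * bj ^ (2:ℕ) * (t₀ - ti) ^ (2:ℕ) * (tj
        - t₀) ^ (2:ℕ) + 16 * a * bi * bj ^ (2:ℕ) * (t₀ - ti) * (tj - t₀) ^ (3:ℕ) + 16 * a * bj ^ (3:ℕ) * ti ^ (2:ℕ) * (t₀ -
        ti) * (tj - t₀) + 24 * a * bj ^ (3:ℕ) * ti * (t₀ - ti) ^ (2:ℕ) * (tj - t₀) + 24 * a * bj ^ (3:ℕ) * ti * (t₀ - ti) *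
        (tj - t₀) ^ (2:ℕ) + 8 * a * bj ^ (3:ℕ) * (t₀ - ti) ^ (3:ℕ) * (tj - t₀) + 16 * a * bj ^ (3:ℕ) * (t₀ - ti) ^ (2:ℕ) * (tj
        - t₀) ^ (2:ℕ) + 8 * a * bj ^ (3:ℕ) * (t₀ - ti) * (tj - t₀) ^ (3:ℕ) + 16 * bi ^ (2:ℕ) * bj ^ (2:ℕ) * ti ^ (2:ℕ) * (t₀ -
        ti) * (tj - t₀) + 16 * bi ^ (2:ℕ) * bj ^ (2:ℕ) * ti ^ (2:ℕ) * (tj - t₀) ^ (2:ℕ) + 24 * bi ^ (2:ℕ) * bj ^ (2:ℕ) * ti *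
        (t₀ - ti) ^ (2:ℕ) * (tj - t₀) + 40 * bi ^ (2:ℕ) * bj ^ (2:ℕ) * ti * (t₀ - ti) * (tj - t₀) ^ (2:ℕ) + 16 * bi ^ (2:ℕ) *
        bj ^ (2:ℕ) * ti * (tj - t₀) ^ (3:ℕ) + 8 * bi ^ (2:ℕ) * bj ^ (2:ℕ) * (t₀ - ti) ^ (3:ℕ) * (tj - t₀) + 16 * bi ^ (2:ℕ) *
        bj ^ (2:ℕ) * (t₀ - ti) ^ (2:ℕ) * (tj - t₀) ^ (2:ℕ) + 8 * bi ^ (2:ℕ) * bj ^ (2:ℕ) * (t₀ - ti) * (tj - t₀) ^ (3:ℕ) + 16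
        * bi * bj ^ (3:ℕ) * ti ^ (2:ℕ) * (t₀ - ti) ^ (2:ℕ) + 16 * bi * bj ^ (3:ℕ) * ti ^ (2:ℕ) * (t₀ - ti) * (tj - t₀) + 32 *
        bi * bj ^ (3:ℕ) * ti * (t₀ - ti) ^ (3:ℕ) + 56 * bi * bj ^ (3:ℕ) * ti * (t₀ - ti) ^ (2:ℕ) * (tj - t₀) + 24 * bi * bj ^
        (3:ℕ) * ti * (t₀ - ti) * (tj - t₀) ^ (2:ℕ) + 16 * bi * bj ^ (3:ℕ) * (t₀ - ti) ^ (4:ℕ) + 40 * bi * bj ^ (3:ℕ) * (t₀ -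
        ti) ^ (3:ℕ) * (tj - t₀) + 32 * bi * bj ^ (3:ℕ) * (t₀ - ti) ^ (2:ℕ) * (tj - t₀) ^ (2:ℕ) + 8 * bi * bj ^ (3:ℕ) * (t₀ -
        ti) * (tj - t₀) ^ (3:ℕ)) := by
    ring
  have h4 : 0 < 4 * (-a * bi * t₀ + a * bi * ti + a * bj * t₀ + a * bj * ti - 2 * a * bj * tj + bi * bj * t₀ + bi * bj * ti - 2 * bi * bj * tj - bj ^ (2:ℕ) * t₀ + bj ^ (2:ℕ) * ti) * ((bj * ((T - tj) + (T + ti)) - bi * ((T - ti) + (T + tj))) * (bj * (T + t₀) * (tj - T) - a * (T + tj) * (T - t₀)) - (bj * (T + ti) * (T - tj) - bi * (T + tj) * (T - ti)) * (bj * ((tj - T) - (T + t₀)) - a * ((T - t₀) + (T + tj)))) := by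
    rw [key]
    have hsq : 0 ≤ (2 * (-a * bi * t₀ + a * bi * ti + a * bj * t₀ + a * bj * ti - 2 * a * bj * tj + bi * bj * t₀ + bi * bj * ti - 2 * bi * bj * tj - bj ^ (2:ℕ) * t₀ + bj ^ (2:ℕ) * ti) * T + (-2 * a * bi * t₀ * tj + 2 * a * bi * ti * tj + 2 * a * bj * t₀ * tj - 2 * a * bj * ti * tj - 2 * bi * bj * t₀ * tj + 2 * bi * bj * ti * tj + 2 * bj ^ (2:ℕ) * t₀ * tj - 2 * bj ^ (2:ℕ) * ti * tj)) ^ (2:ℕ) := sq_nonneg _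
    have hE' : 0 < (16 * a ^ (2:ℕ) * bi * bj * ti ^ (2:ℕ) * (t₀ - ti) ^ (2:ℕ) + 16 * a ^ (2:ℕ) * bi * bj * ti ^ (2:ℕ) * (t₀ - ti) * (tj -
        t₀) + 32 * a ^ (2:ℕ) * bi * bj * ti * (t₀ - ti) ^ (3:ℕ) + 56 * a ^ (2:ℕ) * bi * bj * ti * (t₀ - ti) ^ (2:ℕ) * (tj -
        t₀) + 24 * a ^ (2:ℕ) * bi * bj * ti * (t₀ - ti) * (tj - t₀) ^ (2:ℕ) + 16 * a ^ (2:ℕ) * bi * bj * (t₀ - ti) ^ (4:ℕ) +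
        40 * a ^ (2:ℕ) * bi * bj * (t₀ - ti) ^ (3:ℕ) * (tj - t₀) + 32 * a ^ (2:ℕ) * bi * bj * (t₀ - ti) ^ (2:ℕ) * (tj - t₀) ^
        (2:ℕ) + 8 * a ^ (2:ℕ) * bi * bj * (t₀ - ti) * (tj - t₀) ^ (3:ℕ) + 16 * a ^ (2:ℕ) * bj ^ (2:ℕ) * ti ^ (2:ℕ) * (t₀ - ti)
        * (tj - t₀) + 16 * a ^ (2:ℕ) * bj ^ (2:ℕ) * ti ^ (2:ℕ) * (tj - t₀) ^ (2:ℕ) + 24 * a ^ (2:ℕ) * bj ^ (2:ℕ) * ti * (t₀ -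
        ti) ^ (2:ℕ) * (tj - t₀) + 40 * a ^ (2:ℕ) * bj ^ (2:ℕ) * ti * (t₀ - ti) * (tj - t₀) ^ (2:ℕ) + 16 * a ^ (2:ℕ) * bj ^
        (2:ℕ) * ti * (tj - t₀) ^ (3:ℕ) + 8 * a ^ (2:ℕ) * bj ^ (2:ℕ) * (t₀ - ti) ^ (3:ℕ) * (tj - t₀) + 16 * a ^ (2:ℕ) * bj ^
        (2:ℕ) * (t₀ - ti) ^ (2:ℕ) * (tj - t₀) ^ (2:ℕ) + 8 * a ^ (2:ℕ) * bj ^ (2:ℕ) * (t₀ - ti) * (tj - t₀) ^ (3:ℕ) + 16 * a *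
        bi ^ (2:ℕ) * bj * ti ^ (2:ℕ) * (t₀ - ti) * (tj - t₀) + 24 * a * bi ^ (2:ℕ) * bj * ti * (t₀ - ti) ^ (2:ℕ) * (tj - t₀) +
        24 * a * bi ^ (2:ℕ) * bj * ti * (t₀ - ti) * (tj - t₀) ^ (2:ℕ) + 8 * a * bi ^ (2:ℕ) * bj * (t₀ - ti) ^ (3:ℕ) * (tj -
        t₀) + 16 * a * bi ^ (2:ℕ) * bj * (t₀ - ti) ^ (2:ℕ) * (tj - t₀) ^ (2:ℕ) + 8 * a * bi ^ (2:ℕ) * bj * (t₀ - ti) * (tj -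
        t₀) ^ (3:ℕ) + 32 * a * bi * bj ^ (2:ℕ) * ti ^ (2:ℕ) * (t₀ - ti) ^ (2:ℕ) + 32 * a * bi * bj ^ (2:ℕ) * ti ^ (2:ℕ) * (t₀
        - ti) * (tj - t₀) + 32 * a * bi * bj ^ (2:ℕ) * ti ^ (2:ℕ) * (tj - t₀) ^ (2:ℕ) + 64 * a * bi * bj ^ (2:ℕ) * ti * (t₀ -
        ti) ^ (3:ℕ) + 112 * a * bi * bj ^ (2:ℕ) * ti * (t₀ - ti) ^ (2:ℕ) * (tj - t₀) + 80 * a * bi * bj ^ (2:ℕ) * ti * (t₀ -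
        ti) * (tj - t₀) ^ (2:ℕ) + 32 * a * bi * bj ^ (2:ℕ) * ti * (tj - t₀) ^ (3:ℕ) + 32 * a * bi * bj ^ (2:ℕ) * (t₀ - ti) ^
        (4:ℕ) + 80 * a * bi * bj ^ (2:ℕ) * (t₀ - ti) ^ (3:ℕ) * (tj - t₀) + 64 * a * bi * bj ^ (2:ℕ) * (t₀ - ti) ^ (2:ℕ) * (tj
        - t₀) ^ (2:ℕ) + 16 * a * bi * bj ^ (2:ℕ) * (t₀ - ti) * (tj - t₀) ^ (3:ℕ) + 16 * a * bj ^ (3:ℕ) * ti ^ (2:ℕ) * (t₀ -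
        ti) * (tj - t₀) + 24 * a * bj ^ (3:ℕ) * ti * (t₀ - ti) ^ (2:ℕ) * (tj - t₀) + 24 * a * bj ^ (3:ℕ) * ti * (t₀ - ti) *
        (tj - t₀) ^ (2:ℕ) + 8 * a * bj ^ (3:ℕ) * (t₀ - ti) ^ (3:ℕ) * (tj - t₀) + 16 * a * bj ^ (3:ℕ) * (t₀ - ti) ^ (2:ℕ) * (tj
        - t₀) ^ (2:ℕ) + 8 * a * bj ^ (3:ℕ) * (t₀ - ti) * (tj - t₀) ^ (3:ℕ) + 16 * bi ^ (2:ℕ) * bj ^ (2:ℕ) * ti ^ (2:ℕ) * (t₀ -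
        ti) * (tj - t₀) + 16 * bi ^ (2:ℕ) * bj ^ (2:ℕ) * ti ^ (2:ℕ) * (tj - t₀) ^ (2:ℕ) + 24 * bi ^ (2:ℕ) * bj ^ (2:ℕ) * ti *
        (t₀ - ti) ^ (2:ℕ) * (tj - t₀) + 40 * bi ^ (2:ℕ) * bj ^ (2:ℕ) * ti * (t₀ - ti) * (tj - t₀) ^ (2:ℕ) + 16 * bi ^ (2:ℕ) *
        bj ^ (2:ℕ) * ti * (tj - t₀) ^ (3:ℕ) + 8 * bi ^ (2:ℕ) * bj ^ (2:ℕ) * (t₀ - ti) ^ (3:ℕ) * (tj - t₀) + 16 * bi ^ (2:ℕ) *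
        bj ^ (2:ℕ) * (t₀ - ti) ^ (2:ℕ) * (tj - t₀) ^ (2:ℕ) + 8 * bi ^ (2:ℕ) * bj ^ (2:ℕ) * (t₀ - ti) * (tj - t₀) ^ (3:ℕ) + 16
        * bi * bj ^ (3:ℕ) * ti ^ (2:ℕ) * (t₀ - ti) ^ (2:ℕ) + 16 * bi * bj ^ (3:ℕ) * ti ^ (2:ℕ) * (t₀ - ti) * (tj - t₀) + 32 *
        bi * bj ^ (3:ℕ) * ti * (t₀ - ti) ^ (3:ℕ) + 56 * bi * bj ^ (3:ℕ) * ti * (t₀ - ti) ^ (2:ℕ) * (tj - t₀) + 24 * bi * bj ^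
        (3:ℕ) * ti * (t₀ - ti) * (tj - t₀) ^ (2:ℕ) + 16 * bi * bj ^ (3:ℕ) * (t₀ - ti) ^ (4:ℕ) + 40 * bi * bj ^ (3:ℕ) * (t₀ -
        ti) ^ (3:ℕ) * (tj - t₀) + 32 * bi * bj ^ (3:ℕ) * (t₀ - ti) ^ (2:ℕ) * (tj - t₀) ^ (2:ℕ) + 8 * bi * bj ^ (3:ℕ) * (t₀ -
        ti) * (tj - t₀) ^ (3:ℕ)) := hE
    linarith
  exact neg_of_mul_pos_right h4 (by linarith)

/-- **GENERIC: the quotient-rule numerator factors through the logarithmic derivatives.**  For `P, Q ≠ 0`: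
`(P′Q − PQ′)/Q² = (P/Q)·(P′/P − Q′/Q)`. [folklore] -/
theorem quotDeriv_factor (P Q P' Q' : ℝ) (hP : P ≠ 0) (hQ : Q ≠ 0) :
    (P' * Q - P * Q') / Q ^ (2:ℕ) = (P / Q) * (P' / P - Q' / Q) := by
  field_simp

/-- **GENERIC: normalising the first Cramer identity.**  From `w₀x^{d₀}(−M) = wᵢx^{d₀+m+1}(−P) + wₖx^{d₀+n+1}(−R)` with `M, x ≠ 0`:
`w₀ = wᵢ(P/M)x^{m+1} + wₖ(R/M)x^{n+1}`. [folklore] -/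
theorem branch0_normalise {w₀ wi wk x M P R : ℝ} {d₀ m n : ℕ} (hM : M ≠ 0) (hx : x ≠ 0)
    (e : w₀ * x ^ d₀ * (-M) = wi * x ^ (d₀ + m + 1) * (-P) + wk * x ^ (d₀ + n + 1) * (-R)) :
    w₀ = wi * (P / M) * x ^ (m + 1) + wk * (R / M) * x ^ (n + 1) := by
  have e' : (w₀ * M) * x ^ d₀ = (wi * P * x ^ (m + 1) + wk * R * x ^ (n + 1)) * x ^ d₀ := by
    linear_combination (-1 : ℝ) * e
  have e'' : w₀ * M = wi * P * x ^ (m + 1) + wk * R * x ^ (n + 1) := mul_right_cancel₀ (pow_ne_zero _ hx) e'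
  have h : w₀ = (wi * P * x ^ (m + 1) + wk * R * x ^ (n + 1)) / M := by rw [eq_div_iff hM]; exact e''
  rw [h]
  ring

/-! ## 2. The Cramer coefficient `a₁ = M_{ji}/M_{0j}` decreases along the right window -/

/-- **`a₁′ < 0` ON THE RIGHT WINDOW.**  With `a₁ = M_{ji}/M_{0j}` and its derivative from `hasDerivAt_ratios`:
`a₁′ = a₁·[(Q₀′Qᵢ − Q₀Qᵢ′)/(Q₀Qᵢ) + (1/(T−tᵢ) − 1/(T−t₀))]` and both brackets are negative on the window (`Q₀, Qᵢ < 0` there). [folklore] -/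
theorem coeffA1_deriv_neg {a bi bj t₀ ti tj T : ℝ} (ha : 0 < a) (hbi : 0 < bi) (hbj : 0 < bj) (hti : 0 < ti) (hi0 : ti < t₀) (h0j : t₀ < tj)
    (h0T : t₀ < T) (hTj : T < tj) (hQi : (bj * (T + t₀) * (tj - T) - a * (T + tj) * (T - t₀)) < 0) :
    (((2 * T * (bi * (T - ti) ^ (2:ℕ)) + (T ^ (2:ℕ) - tj ^ (2:ℕ)) * (2 * bi * (T - ti))) - (2 * T * (bj * (T - tj) ^ (2:ℕ)) + (T ^ (2:ℕ) - ti ^ (2:ℕ)) * (2 * bj * (T - tj)))) * ((T ^ (2:ℕ) - t₀ ^ (2:ℕ)) * (bj * (T - tj) ^ (2:ℕ)) - (T ^ (2:ℕ) - tj ^ (2:ℕ)) * (-a * (T - t₀) ^ (2:ℕ))) - ((T ^ (2:ℕ) - tj ^ (2:ℕ)) * (bi * (T - ti) ^ (2:ℕ)) - (T ^ (2:ℕ) - ti ^ (2:ℕ)) * (bj * (T - tj) ^ (2:ℕ))) * ((2 * T * (bj * (T - tj) ^ (2:ℕ)) + (T ^ (2:ℕ) - t₀ ^ (2:ℕ))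 * (2 * bj * (T - tj))) - (2 * T * (-a * (T - t₀) ^ (2:ℕ)) + (T ^ (2:ℕ) - tj ^ (2:ℕ)) * (2 * (-a) * (T - t₀))))) / ((T ^ (2:ℕ) - t₀ ^ (2:ℕ)) * (bj * (T - tj) ^ (2:ℕ)) - (T ^ (2:ℕ) - tj ^ (2:ℕ)) * (-a * (T - t₀) ^ (2:ℕ))) ^ (2:ℕ) < 0 := by
  obtain ⟨q0neg, -, -, -, -, -⟩ := bracket_signs ha hbi hbj hti hi0 h0j
  have hQ0 : (bj * (T + ti) * (T - tj) - bi * (T + tj) * (T - ti)) < 0 := q0neg T (by linarith) hTj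
  obtain ⟨eji, e0j, -, dji, d0j, -⟩ := minors_eq_neg_cross a bi bj t₀ ti tj T
  have l0 : 0 < T - t₀ := by linarith
  have li : 0 < T - ti := by linarith
  have lj : T - tj < 0 := by linarith
  have mji : ((T ^ (2:ℕ) - tj ^ (2:ℕ)) * (bi * (T - ti) ^ (2:ℕ)) - (T ^ (2:ℕ) - ti ^ (2:ℕ)) * (bj * (T - tj) ^ (2:ℕ))) < 0 := by
    rw [eji]; exact neg_neg_of_pos (mul_pos_of_neg_of_neg (mul_neg_of_pos_of_neg li lj) hQ0)
  have m0j : ((T ^ (2:ℕ) - t₀ ^ (2:ℕ)) * (bj * (T - tj) ^ (2:ℕ)) - (T ^ (2:ℕ) - tj ^ (2:ℕ)) * (-a * (T - t₀) ^ (2:ℕ))) < 0 := by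
    rw [e0j]; exact neg_neg_of_pos (mul_pos_of_neg_of_neg (mul_neg_of_neg_of_pos lj l0) hQi)
  have s0 := logDeriv_split (ne_of_lt hQ0) (ne_of_gt li) (ne_of_lt lj) eji dji
  have si := logDeriv_split (ne_of_lt hQi) (ne_of_lt lj) (ne_of_gt l0) e0j d0j
  -- rewrite the derivative as `a₁ · (log a₁)′`
  have e : (((2 * T * (bi * (T - ti) ^ (2:ℕ)) + (T ^ (2:ℕ) - tj ^ (2:ℕ)) * (2 * bi * (T - ti))) - (2 * T * (bj * (T - tj) ^ (2:ℕ)) + (T ^ (2:ℕ) - ti ^ (2:ℕ)) * (2 * bj * (T - tj)))) * ((T ^ (2:ℕ) - t₀ ^ (2:ℕ)) * (bj * (T - tj) ^ (2:ℕ)) - (T ^ (2:ℕ) - tj ^ (2:ℕ)) * (-a * (T - t₀) ^ (2:ℕ))) - ((T ^ (2:ℕ) - tj ^ (2:ℕ)) * (bi * (T - ti) ^ (2:ℕ)) - (T ^ (2:ℕ) - ti ^ (2:ℕ)) * (bj * (T - tj) ^ (2:ℕ))) * ((2 * T * (bj * (T - tj) ^ (2:ℕ)) + (T ^ (2:ℕ)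 - t₀ ^ (2:ℕ)) * (2 * bj * (T - tj))) - (2 * T * (-a * (T - t₀) ^ (2:ℕ)) + (T ^ (2:ℕ) - tj ^ (2:ℕ)) * (2 * (-a) * (T - t₀))))) / ((T ^ (2:ℕ) - t₀ ^ (2:ℕ)) * (bj * (T - tj) ^ (2:ℕ)) - (T ^ (2:ℕ) - tj ^ (2:ℕ)) * (-a * (T - t₀) ^ (2:ℕ))) ^ (2:ℕ)
      = (((T ^ (2:ℕ) - tj ^ (2:ℕ)) * (bi * (T - ti) ^ (2:ℕ)) - (T ^ (2:ℕ) - ti ^ (2:ℕ)) * (bj * (T - tj) ^ (2:ℕ))) / ((T ^ (2:ℕ) - t₀ ^ (2:ℕ)) * (bj * (T - tj) ^ (2:ℕ)) - (T ^ (2:ℕ) - tj ^ (2:ℕ)) * (-a * (T - t₀) ^ (2:ℕ)))) * (((2 * T * (bi * (T - ti) ^ (2:ℕ)) + (T ^ (2:ℕ) - tj ^ (2:ℕ)) * (2 * bi * (T - ti))) - (2 * T * (bj * (T - tj) ^ (2:ℕ)) + (T ^ (2:ℕ) - ti ^ (2:ℕ)) * (2 * bj * (T - tj)))) / ((T ^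 (2:ℕ) - tj ^ (2:ℕ)) * (bi * (T - ti) ^ (2:ℕ)) - (T ^ (2:ℕ) - ti ^ (2:ℕ)) * (bj * (T - tj) ^ (2:ℕ))) - ((2 * T * (bj * (T - tj) ^ (2:ℕ)) + (T ^ (2:ℕ) - t₀ ^ (2:ℕ)) * (2 * bj * (T - tj))) - (2 * T * (-a * (T - t₀) ^ (2:ℕ)) + (T ^ (2:ℕ) - tj ^ (2:ℕ)) * (2 * (-a) * (T - t₀)))) / ((T ^ (2:ℕ) - t₀ ^ (2:ℕ)) * (bj * (T - tj) ^ (2:ℕ)) - (T ^ (2:ℕ) - tj ^ (2:ℕ)) * (-a * (T - t₀) ^ (2:ℕ)))) :=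
    quotDeriv_factor _ _ _ _ (ne_of_lt mji) (ne_of_lt m0j)
  rw [e, s0, si]
  have ha1 : 0 < ((T ^ (2:ℕ) - tj ^ (2:ℕ)) * (bi * (T - ti) ^ (2:ℕ)) - (T ^ (2:ℕ) - ti ^ (2:ℕ)) * (bj * (T - tj) ^ (2:ℕ))) / ((T ^ (2:ℕ) - t₀ ^ (2:ℕ)) * (bj * (T - tj) ^ (2:ℕ)) - (T ^ (2:ℕ) - tj ^ (2:ℕ)) * (-a * (T - t₀) ^ (2:ℕ))) := div_pos_of_neg_of_neg mji m0j
  have hW := wronskian_neg ha hbi hbj hti hi0 h0j T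
  have hQQ : 0 < (bj * (T + ti) * (T - tj) - bi * (T + tj) * (T - ti)) * (bj * (T + t₀) * (tj - T) - a * (T + tj) * (T - t₀)) := mul_pos_of_neg_of_neg hQ0 hQi
  have hfrac : (bj * ((T - tj) + (T + ti)) - bi * ((T - ti) + (T + tj))) / (bj * (T + ti) * (T - tj) - bi * (T + tj) * (T - ti)) - (bj * ((tj - T) - (T + t₀)) - a * ((T - t₀) + (T + tj))) / (bj * (T + t₀) * (tj - T) - a * (T + tj) * (T - t₀)) < 0 := by
    have e2 : (bj * ((T - tj) + (T + ti)) - bi * ((T - ti) + (T + tj))) / (bj * (T + ti) * (T - tj) - bi * (T + tj) * (T - ti)) - (bj * ((tj - T) - (T + t₀)) - a * ((T - t₀) + (T + tj))) / (bj * (T + t₀) * (tj - T) - a * (T + tj) * (T - t₀))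
        = ((bj * ((T - tj) + (T + ti)) - bi * ((T - ti) + (T + tj))) * (bj * (T + t₀) * (tj - T) - a * (T + tj) * (T - t₀)) - (bj * (T + ti) * (T - tj) - bi * (T + tj) * (T - ti)) * (bj * ((tj - T) - (T + t₀)) - a * ((T - t₀) + (T + tj)))) / ((bj * (T + ti) * (T - tj) - bi * (T + tj) * (T - ti)) * (bj * (T + t₀) * (tj - T) - a * (T + tj) * (T - t₀))) := by
      rw [div_sub_div _ _ (ne_of_lt hQ0) (ne_of_lt hQi)]
    rw [e2]
    exact div_neg_of_neg_of_pos hW hQQ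
  have hrec : 1 / (T - ti) - 1 / (T - t₀) < 0 := by
    have : 1 / (T - ti) < 1 / (T - t₀) := one_div_lt_one_div_of_lt l0 (by linarith)
    linarith
  have hbr : ((bj * ((T - tj) + (T + ti)) - bi * ((T - ti) + (T + tj))) / (bj * (T + ti) * (T - tj) - bi * (T + tj) * (T - ti)) + 1 / (T - ti) + 1 / (T - tj)) - ((bj * ((tj - T) - (T + t₀)) - a * ((T - t₀) + (T + tj))) / (bj * (T + t₀) * (tj - T) - a * (T + tj) * (T - t₀)) + 1 / (T - tj) + 1 / (T - t₀)) < 0 := by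
    linarith
  exact mul_neg_of_pos_of_neg ha1 hbr

/-- **`a₁` IS STRICTLY DECREASING ON THE RIGHT WINDOW** `(Tₘ, tⱼ)` (`Tₘ` any point past which `Qᵢ < 0`, e.g. the window edge). [folklore] -/
theorem coeffA1_strictAntiOn {a bi bj t₀ ti tj Tm : ℝ} (ha : 0 < a) (hbi : 0 < bi) (hbj : 0 < bj) (hti : 0 < ti) (hi0 : ti < t₀)
    (h0j : t₀ < tj) (hTm : t₀ ≤ Tm) (hQi : ∀ T : ℝ, Tm < T → (bj * (T + t₀) * (tj - T) - a * (T + tj) * (T - t₀)) < 0) :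
    StrictAntiOn (fun T : ℝ => ((T ^ (2:ℕ) - tj ^ (2:ℕ)) * (bi * (T - ti) ^ (2:ℕ)) - (T ^ (2:ℕ) - ti ^ (2:ℕ)) * (bj * (T - tj) ^ (2:ℕ))) / ((T ^ (2:ℕ) - t₀ ^ (2:ℕ)) * (bj * (T - tj) ^ (2:ℕ)) - (T ^ (2:ℕ) - tj ^ (2:ℕ)) * (-a * (T - t₀) ^ (2:ℕ)))) (Set.Ioo Tm tj) := by
  obtain ⟨q0neg, -, -, -, -, -⟩ := bracket_signs ha hbi hbj hti hi0 h0j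
  have hderiv : ∀ T : ℝ, Tm < T → T < tj → HasDerivAt (fun T : ℝ => ((T ^ (2:ℕ) - tj ^ (2:ℕ)) * (bi * (T - ti) ^ (2:ℕ)) - (T ^ (2:ℕ) - ti ^ (2:ℕ)) * (bj * (T - tj) ^ (2:ℕ))) / ((T ^ (2:ℕ) - t₀ ^ (2:ℕ)) * (bj * (T - tj) ^ (2:ℕ)) - (T ^ (2:ℕ) - tj ^ (2:ℕ)) * (-a * (T - t₀) ^ (2:ℕ))))
      ((((2 * T * (bi * (T - ti) ^ (2:ℕ)) + (T ^ (2:ℕ) - tj ^ (2:ℕ)) * (2 * bi * (T - ti))) - (2 * T * (bj * (T - tj) ^ (2:ℕ)) + (T ^ (2:ℕ) - ti ^ (2:ℕ)) * (2 * bj * (T - tj)))) * ((T ^ (2:ℕ) - t₀ ^ (2:ℕ)) * (bj * (T - tj) ^ (2:ℕ)) - (T ^ (2:ℕ) - tj ^ (2:ℕ)) * (-a * (T - t₀) ^ (2:ℕ))) - ((T ^ (2:ℕ) - tj ^ (2:ℕ)) * (bi * (T - ti) ^ (2:ℕ)) - (T ^ (2:ℕ) - ti ^ (2:ℕ)) *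 (bj * (T - tj) ^ (2:ℕ))) * ((2 * T * (bj * (T - tj) ^ (2:ℕ)) + (T ^ (2:ℕ) - t₀ ^ (2:ℕ)) * (2 * bj * (T - tj))) - (2 * T * (-a * (T - t₀) ^ (2:ℕ)) + (T ^ (2:ℕ) - tj ^ (2:ℕ)) * (2 * (-a) * (T - t₀))))) / ((T ^ (2:ℕ) - t₀ ^ (2:ℕ)) * (bj * (T - tj) ^ (2:ℕ)) - (T ^ (2:ℕ) - tj ^ (2:ℕ)) * (-a * (T - t₀) ^ (2:ℕ))) ^ (2:ℕ)) T := by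
    intro T h1 h2
    have hQ0 : (bj * (T + ti) * (T - tj) - bi * (T + tj) * (T - ti)) < 0 := q0neg T (by linarith) h2
    obtain ⟨-, e0j, -, -, -, -⟩ := minors_eq_neg_cross a bi bj t₀ ti tj T
    have m0j : ((T ^ (2:ℕ) - t₀ ^ (2:ℕ)) * (bj * (T - tj) ^ (2:ℕ)) - (T ^ (2:ℕ) - tj ^ (2:ℕ)) * (-a * (T - t₀) ^ (2:ℕ))) ≠ 0 := by
      rw [e0j]
      exact neg_ne_zero.mpr (mul_ne_zero (mul_ne_zero (ne_of_lt (by linarith)) (ne_of_gt (by linarith))) (ne_of_lt (hQi T h1)))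
    exact (hasDerivAt_ratios m0j).1
  refine strictAntiOn_of_deriv_neg (convex_Ioo Tm tj) ?_ ?_
  · intro T hT
    exact (hderiv T hT.1 hT.2).continuousAt.continuousWithinAt
  · intro T hT
    rw [interior_Ioo] at hT
    rw [(hderiv T hT.1 hT.2).deriv]
    exact coeffA1_deriv_neg ha hbi hbj hti hi0 h0j (by linarith [hT.1]) hT.2 (hQi T hT.1)

/-! ## 3. Along branch `0` the scale increases with the direction -/

/-- **BRANCH `0`: THE SCALE INCREASES WITH THE DIRECTION.**  Let `Tₘ < T₁ < T₂ < tⱼ` be two directions on the right window (both beyond the edges of the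
triples `{0,i,j}` and `{0,k,j}`: `Qᵢ-brackets < 0` past `Tₘ`) and let `x₁, x₂ > 0` satisfy the first Cramer identity at `T₁`, `T₂` respectively:
`w₀x^{d₀}(−M_{0j}) = wᵢx^{dᵢ}(−M_{ji}) + wₖx^{dₖ}(−M_{jk})` with `d₀ < dᵢ`, `d₀ < dₖ`.  Then `x₁ < x₂`.  (After division: `w₀ = wᵢ a₁(T) x^{dᵢ−d₀} +
wₖ b₁(T) x^{dₖ−d₀}` with `a₁, b₁` strictly decreasing in `T` and the right side strictly increasing in `x`.) [folklore] -/
theorem branch0_scale_strictMono {a bi bk bj t₀ ti tk tj Tm T₁ T₂ w₀ wi wk x₁ x₂ : ℝ} {d₀ di dk : ℕ}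
    (ha : 0 < a) (hbi : 0 < bi) (hbk : 0 < bk) (hbj : 0 < bj) (hti : 0 < ti) (htk : 0 < tk) (hi0 : ti < t₀) (hk0 : tk < t₀)
    (h0j : t₀ < tj) (hTm : t₀ ≤ Tm) (hQi : ∀ T : ℝ, Tm < T → (bj * (T + t₀) * (tj - T) - a * (T + tj) * (T - t₀)) < 0)
    (hQk : ∀ T : ℝ, Tm < T → bj * (T + t₀) * (tj - T) - a * (T + tj) * (T - t₀) < 0)
    (hwi : 0 < wi) (hwk : 0 < wk) (h0i : d₀ < di) (h0k : d₀ < dk) (hx₁ : 0 < x₁) (hx₂ : 0 < x₂)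
    (h1 : Tm < T₁) (h12 : T₁ < T₂) (h2 : T₂ < tj)
    (e₁ : w₀ * x₁ ^ d₀ * (-((T₁ ^ (2:ℕ) - t₀ ^ (2:ℕ)) * (bj * (T₁ - tj) ^ (2:ℕ)) - (T₁ ^ (2:ℕ) - tj ^ (2:ℕ)) * (-a * (T₁ - t₀) ^ (2:ℕ))))
        = wi * x₁ ^ di * (-((T₁ ^ (2:ℕ) - tj ^ (2:ℕ)) * (bi * (T₁ - ti) ^ (2:ℕ)) - (T₁ ^ (2:ℕ) - ti ^ (2:ℕ)) * (bj * (T₁ - tj) ^ (2:ℕ))))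
          + wk * x₁ ^ dk * (-((T₁ ^ (2:ℕ) - tj ^ (2:ℕ)) * (bk * (T₁ - tk) ^ (2:ℕ)) - (T₁ ^ (2:ℕ) - tk ^ (2:ℕ)) * (bj * (T₁ - tj) ^ (2:ℕ)))))
    (e₂ : w₀ * x₂ ^ d₀ * (-((T₂ ^ (2:ℕ) - t₀ ^ (2:ℕ)) * (bj * (T₂ - tj) ^ (2:ℕ)) - (T₂ ^ (2:ℕ) - tj ^ (2:ℕ)) * (-a * (T₂ - t₀) ^ (2:ℕ))))
        = wi * x₂ ^ di * (-((T₂ ^ (2:ℕ) - tj ^ (2:ℕ)) * (bi * (T₂ - ti) ^ (2:ℕ)) - (T₂ ^ (2:ℕ) - ti ^ (2:ℕ)) * (bj * (T₂ - tj) ^ (2:ℕ))))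
          + wk * x₂ ^ dk * (-((T₂ ^ (2:ℕ) - tj ^ (2:ℕ)) * (bk * (T₂ - tk) ^ (2:ℕ)) - (T₂ ^ (2:ℕ) - tk ^ (2:ℕ)) * (bj * (T₂ - tj) ^ (2:ℕ))))) :
    x₁ < x₂ := by
  -- the two Cramer coefficients `a₁ = M_{ji}/M_{0j}`, `b₁ = M_{jk}/M_{0j}` are positive and strictly decreasing on the window
  have antiA := coeffA1_strictAntiOn ha hbi hbj hti hi0 h0j hTm hQi
  have antiB := coeffA1_strictAntiOn ha hbk hbj htk hk0 h0j hTm hQk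
  have hA : ((T₂ ^ (2:ℕ) - tj ^ (2:ℕ)) * (bi * (T₂ - ti) ^ (2:ℕ)) - (T₂ ^ (2:ℕ) - ti ^ (2:ℕ)) * (bj * (T₂ - tj) ^ (2:ℕ))) / ((T₂ ^ (2:ℕ) - t₀ ^ (2:ℕ)) * (bj * (T₂ - tj) ^ (2:ℕ)) - (T₂ ^ (2:ℕ) - tj ^ (2:ℕ)) * (-a * (T₂ - t₀) ^ (2:ℕ))) < ((T₁ ^ (2:ℕ) - tj ^ (2:ℕ)) * (bi * (T₁ - ti) ^ (2:ℕ)) - (T₁ ^ (2:ℕ) - ti ^ (2:ℕ)) * (bj * (T₁ - tj) ^ (2:ℕ))) / ((T₁ ^ (2:ℕ) - t₀ ^ (2:ℕ)) * (bj * (T₁ - tj) ^ (2:ℕ)) - (T₁ ^ (2:ℕ) - tj ^ (2:ℕ)) * (-a * (T₁ - t₀) ^ (2:ℕ))) := antiA ⟨h1, by linarith⟩ ⟨by linarith, h2⟩ h12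
  have hB : ((T₂ ^ (2:ℕ) - tj ^ (2:ℕ)) * (bk * (T₂ - tk) ^ (2:ℕ)) - (T₂ ^ (2:ℕ) - tk ^ (2:ℕ)) * (bj * (T₂ - tj) ^ (2:ℕ))) / ((T₂ ^ (2:ℕ) - t₀ ^ (2:ℕ)) * (bj * (T₂ - tj) ^ (2:ℕ)) - (T₂ ^ (2:ℕ) - tj ^ (2:ℕ)) * (-a * (T₂ - t₀) ^ (2:ℕ)))
      < ((T₁ ^ (2:ℕ) - tj ^ (2:ℕ)) * (bk * (T₁ - tk) ^ (2:ℕ)) - (T₁ ^ (2:ℕ) - tk ^ (2:ℕ)) * (bj * (T₁ - tj) ^ (2:ℕ))) / ((T₁ ^ (2:ℕ) - t₀ ^ (2:ℕ)) * (bj * (T₁ - tj) ^ (2:ℕ)) - (T₁ ^ (2:ℕ) - tj ^ (2:ℕ)) * (-a * (T₁ - t₀) ^ (2:ℕ))) :=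
    antiB ⟨h1, by linarith⟩ ⟨by linarith, h2⟩ h12
  -- signs of `M_{0j}` at both directions
  have m0j : ∀ T : ℝ, Tm < T → T < tj → ((T ^ (2:ℕ) - t₀ ^ (2:ℕ)) * (bj * (T - tj) ^ (2:ℕ)) - (T ^ (2:ℕ) - tj ^ (2:ℕ)) * (-a * (T - t₀) ^ (2:ℕ))) < 0 := by
    intro T hT1 hT2
    obtain ⟨-, e0j, -, -, -, -⟩ := minors_eq_neg_cross a bi bj t₀ ti tj T
    rw [e0j]
    exact neg_neg_of_pos (mul_pos_of_neg_of_neg (mul_neg_of_neg_of_pos (by linarith) (by linarith)) (hQi T hT1))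
  have n1 : 0 < -((T₁ ^ (2:ℕ) - t₀ ^ (2:ℕ)) * (bj * (T₁ - tj) ^ (2:ℕ)) - (T₁ ^ (2:ℕ) - tj ^ (2:ℕ)) * (-a * (T₁ - t₀) ^ (2:ℕ))) := by linarith [m0j T₁ h1 (by linarith)]
  have n2 : 0 < -((T₂ ^ (2:ℕ) - t₀ ^ (2:ℕ)) * (bj * (T₂ - tj) ^ (2:ℕ)) - (T₂ ^ (2:ℕ) - tj ^ (2:ℕ)) * (-a * (T₂ - t₀) ^ (2:ℕ))) := by linarith [m0j T₂ (by linarith) h2]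
  -- normalised equations: w₀ = wᵢ·a₁(T)·x^{dᵢ−d₀} + wₖ·b₁(T)·x^{dₖ−d₀}
  obtain ⟨m, rfl⟩ := Nat.exists_eq_add_of_lt h0i
  obtain ⟨n, rfl⟩ := Nat.exists_eq_add_of_lt h0k
  set A₁ := ((T₁ ^ (2:ℕ) - tj ^ (2:ℕ)) * (bi * (T₁ - ti) ^ (2:ℕ)) - (T₁ ^ (2:ℕ) - ti ^ (2:ℕ)) * (bj * (T₁ - tj) ^ (2:ℕ))) / ((T₁ ^ (2:ℕ) - t₀ ^ (2:ℕ)) * (bj * (T₁ - tj) ^ (2:ℕ)) - (T₁ ^ (2:ℕ) - tj ^ (2:ℕ)) * (-a * (T₁ - t₀) ^ (2:ℕ))) with hA₁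
  set A₂ := ((T₂ ^ (2:ℕ) - tj ^ (2:ℕ)) * (bi * (T₂ - ti) ^ (2:ℕ)) - (T₂ ^ (2:ℕ) - ti ^ (2:ℕ)) * (bj * (T₂ - tj) ^ (2:ℕ))) / ((T₂ ^ (2:ℕ) - t₀ ^ (2:ℕ)) * (bj * (T₂ - tj) ^ (2:ℕ)) - (T₂ ^ (2:ℕ) - tj ^ (2:ℕ)) * (-a * (T₂ - t₀) ^ (2:ℕ))) with hA₂
  set B₁ := ((T₁ ^ (2:ℕ) - tj ^ (2:ℕ)) * (bk * (T₁ - tk) ^ (2:ℕ)) - (T₁ ^ (2:ℕ) - tk ^ (2:ℕ)) * (bj * (T₁ - tj) ^ (2:ℕ))) / ((T₁ ^ (2:ℕ) - t₀ ^ (2:ℕ)) * (bj * (T₁ - tj) ^ (2:ℕ)) - (T₁ ^ (2:ℕ) - tj ^ (2:ℕ)) * (-a * (T₁ - t₀) ^ (2:ℕ))) with hB₁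
  set B₂ := ((T₂ ^ (2:ℕ) - tj ^ (2:ℕ)) * (bk * (T₂ - tk) ^ (2:ℕ)) - (T₂ ^ (2:ℕ) - tk ^ (2:ℕ)) * (bj * (T₂ - tj) ^ (2:ℕ))) / ((T₂ ^ (2:ℕ) - t₀ ^ (2:ℕ)) * (bj * (T₂ - tj) ^ (2:ℕ)) - (T₂ ^ (2:ℕ) - tj ^ (2:ℕ)) * (-a * (T₂ - t₀) ^ (2:ℕ))) with hB₂
  have f₁ : w₀ = wi * A₁ * x₁ ^ (m + 1) + wk * B₁ * x₁ ^ (n + 1) :=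
    branch0_normalise (ne_of_lt (m0j T₁ h1 (by linarith))) hx₁.ne' e₁
  have f₂ : w₀ = wi * A₂ * x₂ ^ (m + 1) + wk * B₂ * x₂ ^ (n + 1) :=
    branch0_normalise (ne_of_lt (m0j T₂ (by linarith) h2)) hx₂.ne' e₂
  -- positivity of the coefficients at `T₂` (hence at `T₁`)
  have pA2 : 0 < A₂ := by
    obtain ⟨q0neg, -, -, -, -, -⟩ := bracket_signs ha hbi hbj hti hi0 h0j
    obtain ⟨eji, -, -, -, -, -⟩ := minors_eq_neg_cross a bi bj t₀ ti tj T₂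
    have mji : ((T₂ ^ (2:ℕ) - tj ^ (2:ℕ)) * (bi * (T₂ - ti) ^ (2:ℕ)) - (T₂ ^ (2:ℕ) - ti ^ (2:ℕ)) * (bj * (T₂ - tj) ^ (2:ℕ))) < 0 := by
      rw [eji]
      exact neg_neg_of_pos (mul_pos_of_neg_of_neg (mul_neg_of_pos_of_neg (by linarith) (by linarith)) (q0neg T₂ (by linarith) h2))
    exact div_pos_of_neg_of_neg mji (m0j T₂ (by linarith) h2)
  have pB2 : 0 < B₂ := by
    obtain ⟨q0neg, -, -, -, -, -⟩ := bracket_signs ha hbk hbj htk hk0 h0j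
    obtain ⟨ejk, -, -, -, -, -⟩ := minors_eq_neg_cross a bk bj t₀ tk tj T₂
    have mjk : ((T₂ ^ (2:ℕ) - tj ^ (2:ℕ)) * (bk * (T₂ - tk) ^ (2:ℕ)) - (T₂ ^ (2:ℕ) - tk ^ (2:ℕ)) * (bj * (T₂ - tj) ^ (2:ℕ))) < 0 := by
      rw [ejk]
      exact neg_neg_of_pos (mul_pos_of_neg_of_neg (mul_neg_of_pos_of_neg (by linarith) (by linarith)) (q0neg T₂ (by linarith) h2))
    exact div_pos_of_neg_of_neg mjk (m0j T₂ (by linarith) h2)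
  -- if `x₂ ≤ x₁` the right side at `(T₂, x₂)` is strictly smaller than at `(T₁, x₁)`: contradiction
  by_contra hnot
  push Not at hnot
  have px1 : x₂ ^ (m + 1) ≤ x₁ ^ (m + 1) := pow_le_pow_left₀ hx₂.le hnot _
  have px2 : x₂ ^ (n + 1) ≤ x₁ ^ (n + 1) := pow_le_pow_left₀ hx₂.le hnot _
  have q1 : 0 < x₁ ^ (m + 1) := pow_pos hx₁ _
  have q2 : 0 < x₁ ^ (n + 1) := pow_pos hx₁ _
  have s1 : wi * A₂ * x₂ ^ (m + 1) ≤ wi * A₂ * x₁ ^ (m + 1) := mul_le_mul_of_nonneg_left px1 (mul_pos hwi pA2).le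
  have s2 : wk * B₂ * x₂ ^ (n + 1) ≤ wk * B₂ * x₁ ^ (n + 1) := mul_le_mul_of_nonneg_left px2 (mul_pos hwk pB2).le
  have s3 : wi * A₂ * x₁ ^ (m + 1) < wi * A₁ * x₁ ^ (m + 1) := by
    have := mul_lt_mul_of_pos_left hA hwi
    exact mul_lt_mul_of_pos_right this q1
  have s4 : wk * B₂ * x₁ ^ (n + 1) < wk * B₁ * x₁ ^ (n + 1) := by
    have := mul_lt_mul_of_pos_left hB hwk
    exact mul_lt_mul_of_pos_right this q2
  linarith

end Summit.ValiantsHypothesis.ValiantsHypothesis.Theorems.LacunarySymmetroidMatrixDescartes.Pivot.CriticalWindows.Four
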